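import Mathlib
import Summits.Ventures.PercRepro.TriangleCapTwoTrianglesEightD

/-!
# PercRepro — THE TWO-TRIANGLE CASE OF THE `r = 2` STABILITY FOR TRIANGLES SHARING A VERTEX, `k ≥ 8`
(p3, gen 37; part 59)

* **`card_triangles3_le_twelve_of_shared`** — at most twelve ordered triangles when every triangle lies in
  `S = T₁ ∪ T₂` (`T₁ ∩ T₂ = {t}`) and an edge lies in at most one triangle: an adjacent pair of `S` lies inside `T₁`
  or inside `T₂`, since a vertex of `T₁ ∖ T₂` adjacent to a vertex of `T₂ ∖ T₁` would have two neighbours in `T₂`;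
* **`two_triangles_stability_two_of_shared_eight`** — `K₄⁻`-free, `k ≥ 8`, `m ≥ 2k − 3`, two triangles `u v w`,
  `a b c` (`a ∉ {u, v, w}`) with a common vertex, every triangle on `{u, v, w, a, b, c}` ⇒
  `Σ_v d(v)² + 2 (k − 3) ≤ m k` — from the far count of TriangleCapTwoTrianglesEightD and
  `2 Σ d² + Σ deficit = 2mk + |T₃|`.
Axioms: standard.
-/

namespace PercRepro

namespace TriangleCap

namespace C047

open Finset

variable {V : Type*} [Fintype V] [DecidableEq V]

/-- **AT MOST TWELVE ORDERED TRIANGLES** for two triangles sharing the vertex `t`: every triangle lies in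
`S = T₁ ∪ T₂`, and an adjacent pair of `S` lies inside `T₁` or inside `T₂` (a vertex of `T₁ ∖ T₂` adjacent to a
vertex of `T₂ ∖ T₁` would have two neighbours in `T₂`). -/
theorem card_triangles3_le_twelve_of_shared (D : SimpleGraph V) [DecidableRel D.Adj] (T₁ T₂ : Finset V)
    (h₁ : T₁.card = 3) (h₂ : T₂.card = 3) {t : V} (hint : T₁ ∩ T₂ = {t})
    (hcl₁ : ∀ x ∈ T₁, ∀ y ∈ T₁, x ≠ y → D.Adj x y) (hcl₂ : ∀ x ∈ T₂, ∀ y ∈ T₂, x ≠ y → D.Adj x y)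
    (hone₂ : ∀ z, z ∉ T₂ → degIn D T₂ z ≤ 1)
    (hT : ∀ x y z, D.Adj x y → D.Adj x z → D.Adj y z → x ∈ T₁ ∪ T₂)
    (hcodeg : ∀ x y z z', D.Adj x y → D.Adj x z → D.Adj y z → D.Adj x z' → D.Adj y z' → z = z') :
    (triangles3 D).card ≤ 12 := by
  have ht1 : t ∈ T₁ := (mem_inter.mp (by rw [hint]; exact mem_singleton_self t)).1
  have ht2 : t ∈ T₂ := (mem_inter.mp (by rw [hint]; exact mem_singleton_self t)).2
  have hone : ∀ (T : Finset V), (∀ z, z ∉ T → degIn D T z ≤ 1) → ∀ z, z ∉ T → ∀ p ∈ T, ∀ q ∈ T,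
      D.Adj z p → D.Adj z q → p = q := by
    intro T hT z hz p hp q hq hzp hzq
    have h := hT z hz
    unfold degIn at h
    exact card_le_one.mp h p (mem_filter.mpr ⟨hp, hzp⟩) q (mem_filter.mpr ⟨hq, hzq⟩)
  -- an adjacent pair of `S` lies inside `T₁` or inside `T₂`
  have hpair : ∀ x y, D.Adj x y → x ∈ T₁ ∪ T₂ → y ∈ T₁ ∪ T₂ →
      (x ∈ T₁ ∧ y ∈ T₁) ∨ (x ∈ T₂ ∧ y ∈ T₂) := by
    intro x y hxy hx hy
    rw [mem_union] at hx hy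
    rcases hx with hx | hx <;> rcases hy with hy | hy
    · exact Or.inl ⟨hx, hy⟩
    · by_cases hx2 : x ∈ T₂
      · exact Or.inr ⟨hx2, hy⟩
      · by_cases hy1 : y ∈ T₁
        · exact Or.inl ⟨hx, hy1⟩
        · exfalso
          have hxt : x ≠ t := fun h => hx2 (h ▸ ht2)
          have := hone T₂ hone₂ x hx2 y hy t ht2 hxy (hcl₁ x hx t ht1 hxt)
          exact hy1 (this ▸ ht1)
    · by_cases hy2 : y ∈ T₂
      · exact Or.inr ⟨hx, hy2⟩
      · by_cases hx1 : x ∈ T₁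
        · exact Or.inl ⟨hx1, hy⟩
        · exfalso
          have hyt : y ≠ t := fun h => hy2 (h ▸ ht2)
          have := hone T₂ hone₂ y hy2 x hx t ht2 hxy.symm (hcl₁ y hy t ht1 hyt)
          exact hx1 (this ▸ ht1)
    · exact Or.inr ⟨hx, hy⟩
  have hP₁ : ((T₁ ×ˢ T₁).filter (fun p : V × V => D.Adj p.1 p.2)).card = 6 := by
    have := adjPairs_eq_sum_degIn D T₁
    unfold adjPairs at this
    rw [this, sum_congr rfl (fun x hx => degIn_self_of_clique D h₁ hcl₁ hx), sum_const, h₁, smul_eq_mul]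
  have hP₂ : ((T₂ ×ˢ T₂).filter (fun p : V × V => D.Adj p.1 p.2)).card = 6 := by
    have := adjPairs_eq_sum_degIn D T₂
    unfold adjPairs at this
    rw [this, sum_congr rfl (fun x hx => degIn_self_of_clique D h₂ hcl₂ hx), sum_const, h₂, smul_eq_mul]
  set U : Finset (V × V) := (T₁ ×ˢ T₁).filter (fun p : V × V => D.Adj p.1 p.2) ∪
    (T₂ ×ˢ T₂).filter (fun p : V × V => D.Adj p.1 p.2) with hU
  clear_value U
  have hmaps : Set.MapsTo (fun t : (V × V) × V => t.1) (triangles3 D : Set ((V × V) × V))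
      (U : Set (V × V)) := by
    intro s hs
    rw [mem_coe, triangles3, mem_filter, mem_product, mem_adjPairsAll] at hs
    obtain ⟨⟨hxy, -⟩, hxz, hyz⟩ := hs
    rw [mem_coe, hU, mem_union, mem_filter, mem_filter, mem_product, mem_product]
    have hx := hT s.1.1 s.1.2 s.2 hxy hxz hyz
    have hy := hT s.1.2 s.1.1 s.2 hxy.symm hyz hxz
    rcases hpair s.1.1 s.1.2 hxy hx hy with ⟨h1, h2⟩ | ⟨h1, h2⟩
    · exact Or.inl ⟨⟨h1, h2⟩, hxy⟩
    · exact Or.inr ⟨⟨h1, h2⟩, hxy⟩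
  have hinj : Set.InjOn (fun t : (V × V) × V => t.1) (triangles3 D) := by
    intro s hs s' hs' h
    simp only at h
    rw [mem_coe, triangles3, mem_filter, mem_product, mem_adjPairsAll] at hs hs'
    obtain ⟨⟨hxy, -⟩, hxz, hyz⟩ := hs
    obtain ⟨⟨-, -⟩, hxz', hyz'⟩ := hs'
    rw [← h] at hxz' hyz'
    have := hcodeg s.1.1 s.1.2 s.2 s'.2 hxy hxz hyz hxz' hyz'
    exact Prod.ext h this
  have := card_le_card_of_injOn _ hmaps hinj
  have hu := card_union_le ((T₁ ×ˢ T₁).filter (fun p : V × V => D.Adj p.1 p.2))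
    ((T₂ ×ˢ T₂).filter (fun p : V × V => D.Adj p.1 p.2))
  rw [← hU] at hu
  omega

/-- **THE TWO-TRIANGLE CASE OF THE `r = 2` STABILITY FOR TRIANGLES SHARING A VERTEX AND EVERY `k ≥ 8`:**
`K₄⁻`-free, `m ≥ 2k − 3`, two triangles `u v w`, `a b c` (`a ∉ {u, v, w}`) with a common vertex `t`, every triangle
on `{u, v, w, a, b, c}` ⇒ `Σ_v d(v)² + 2 (k − 3) ≤ m k`. -/
theorem two_triangles_stability_two_of_shared_eight (D : SimpleGraph V) [DecidableRel D.Adj] (hK : K4mFree D)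
    (hk : 8 ≤ Fintype.card V) (hm : 2 * Fintype.card V ≤ D.edgeFinset.card + 3) {u v w a b c : V}
    (huv : D.Adj u v) (huw : D.Adj u w) (hvw : D.Adj v w) (hab : D.Adj a b) (hac : D.Adj a c) (hbc : D.Adj b c)
    (ha : ¬ (a = u ∨ a = v ∨ a = w))
    (hT3 : ∀ x y z, D.Adj x y → D.Adj x z → D.Adj y z → x = u ∨ x = v ∨ x = w ∨ x = a ∨ x = b ∨ x = c)
    {t : V} (ht : (t = u ∨ t = v ∨ t = w) ∧ (t = a ∨ t = b ∨ t = c)) :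
    ∑ v, deg D v * deg D v + 2 * (Fintype.card V - 3) ≤ D.edgeFinset.card * Fintype.card V := by
  set T₁ : Finset V := {u, v, w} with hT₁
  set T₂ : Finset V := {a, b, c} with hT₂
  have h₁ : T₁.card = 3 := card_triple huv.ne huw.ne hvw.ne
  have h₂ : T₂.card = 3 := card_triple hab.ne hac.ne hbc.ne
  have hint : T₁ ∩ T₂ = {t} := by
    ext x
    rw [mem_inter, mem_singleton, hT₁, hT₂]
    simp only [mem_insert, mem_singleton]
    constructor
    · intro hx
      exact shared_unique' D hK huv huw hvw hab hac hbc ha hx ht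
    · rintro rfl
      exact ht
  have hcl₁ := clique_triple D huv huw hvw
  have hcl₂ := clique_triple D hab hac hbc
  have hone₁ : ∀ z, z ∉ T₁ → degIn D T₁ z ≤ 1 := fun z hz => degIn_le_one_of_triangle D hK huv huw hvw hz
  have hone₂ : ∀ z, z ∉ T₂ → degIn D T₂ z ≤ 1 := fun z hz => degIn_le_one_of_triangle D hK hab hac hbc hz
  have hT : ∀ x y z, D.Adj x y → D.Adj x z → D.Adj y z → x ∈ T₁ ∪ T₂ := by
    intro x y z hxy hxz hyz
    rw [hT₁, hT₂, mem_union]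
    simp only [mem_insert, mem_singleton]
    rcases hT3 x y z hxy hxz hyz with h | h | h | h | h | h
    · exact Or.inl (Or.inl h)
    · exact Or.inl (Or.inr (Or.inl h))
    · exact Or.inl (Or.inr (Or.inr h))
    · exact Or.inr (Or.inl h)
    · exact Or.inr (Or.inr (Or.inl h))
    · exact Or.inr (Or.inr (Or.inr h))
  have hdef := four_mul_card_le_sum_deficit_of_shared D T₁ T₂ h₁ h₂ hint hcl₁ hcl₂ hone₁ hone₂ hT hk hm
  have h12 := card_triangles3_le_twelve_of_shared D T₁ T₂ h₁ h₂ hint hcl₁ hcl₂ hone₂ hT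
    (fun x y z z' hxy hxz hyz hxz' hyz' => eq_of_common_nbr D hK hxy hxz hyz hxz' hyz')
  have hid := two_mul_sum_deg_sq_add_sum_deficit D
  have hmk : 2 * (D.edgeFinset.card * Fintype.card V) = 2 * D.edgeFinset.card * Fintype.card V := by ring
  omega

end C047

end TriangleCap

end PercRepro
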